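import Summits.QuantumFields.YangMills.Theorems.BalabanUVNodesN15TwoGridL2Blocks
import Summits.QuantumFields.YangMills.Theorems.BalabanUVNodesN15TwoGridHolderSteps
import HarnessLib

/-!
# N15 (NE2) — Bałaban's full propagator pair, part 70: FROM L²-BLOCK TO SUP-BLOCK MAJORANTS — sub-box averages of side `ℓ ∣ n` and multi-step oscillations

WHO / WHEN.  Cell `pub-ymgap`, seat `pub-ymgap-dag-n15-a` (KNIT-BY-NAME, g13); `--supports stmt-QuantumFields-20507 --as helper` (count-neutral); `HOME/pub-ymgap-dag-n15-a/DOOR-IV-PLAN.md` §7.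
Over parts 61 (`BlockNorm.l2Blocks`), 40 (`hasMaj_sT_pow_comp`), 34 (`symbOp`, `sT_pow`, `symbOp_single_apply`), King's `val_blockOf`.
WHAT.  The elementary interpolation that turns entry 2's L²-block majorant (part 69) into the sup-block majorant the readout wants.  (§109) `boxPt x t`: the point of the sub-box of side `ℓ` of
`x`'s unit block with offset `t` from the sub-box corner (coordinates `n⌊v∕n⌋ + ℓ⌊(v mod n)∕ℓ⌋ + t_i`), `boxPt_val`, `blockOf_boxPt` (same unit block, `ℓ ∣ n`, `t < ℓ`), `boxPt_rem` (`x` itself),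
`boxPt_eq_corner_add`, `boxPt_injective`; `subAvg ℓ` (one data def: the average over the sub-box, a linear operator); `symbOp_prod_sT_pow_apply`.  (§110) ★ `loc_subAvg_le`:
`sup_{B(y)} |subAvg g| ≤ √((n∕ℓ)^{d+1})·loc_{L²,η^{d+1}}(y, g)` (Cauchy–Schwarz on `ℓ^{d+1}` points, injectivity) and `HasMaj.subAvg_of_l2Blocks`; (§111) `hasMaj_prod_sT_pow_sub_one` (a product of
`d+1` directional `t_i`-step differences from the single-direction ones, `(d+1)e^{(d+1)ρ}`), ★ `hasMaj_sub_subAvg` (`g − subAvg g` at `x` = two corner-based box oscillations);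
(§112) ★★ `hasMaj_sup_of_l2Blocks_osc`: `HasMaj (L²-blocks) T (B₂e^{−ρd})` and `HasMaj (sup) ((ρ(s_i^t) − 1)∘T) (B_osc e^{−ρd})` for all `i`, `t < ℓ` give
`HasMaj (sup) T ((√((n∕ℓ)^{d+1})·B₂ + 2(d+1)e^{(d+1)ρ}B_osc)·e^{−ρd})`.
HONEST FRAMING ∕ LIMITS.  Finite-lattice bookkeeping ([folklore]); count-neutral (typed 28∕28 · discharged 5∕27 of record unchanged); NOT a discharge of N15 (`NE2PlusOperator`, object-bound);
not ℝ⁴ ∕ OS ∕ mass gap ∕ Clay.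
-/

open scoped BigOperators
open Finset

namespace Summit.QuantumFields.YangMills.BalabanUVNodes.N15.TwoGrid

open Literature.MathematicalPhysics.QuantumFieldTheory.Balaban1983to89
open Literature.MathematicalPhysics.QuantumFieldTheory.Balaban1983to89.B11SectG (BlockNorm HasMaj)
open Literature.MathematicalPhysics.QuantumFieldTheory.Balaban1983to89.B11AxialTransport190 (abs_le_loc_ofBlocks loc_ofBlocks_le)
open Literature.MathematicalPhysics.QuantumFieldTheory.Balaban1983to89.B5Prop11Plancherel (Tor fine unitVec)
open Literature.MathematicalPhysics.QuantumFieldTheory.Balaban1983to89.B5SettingP12Weighted (etaPow etaPow_nonneg)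
open Literature.MathematicalPhysics.QuantumFieldTheory.King1986.Torus (blockOf val_blockOf tdistT tdistT_nonneg)
open Literature.MathematicalPhysics.QuantumFieldTheory.Balaban1983to89.B6UnitTorusCarrier (unitTorusGeo)

variable {d : ℕ}

/-! ## §109 Sub-boxes of side `ℓ` of a unit block -/

section Box

variable (M : Fin (d + 1) → ℕ) [∀ μ, NeZero (M μ)] (n : ℕ) [NeZero n] (ℓ : ℕ)

/-- the point with offset `t` from the corner of the side-`ℓ` sub-box of `x`'s unit block containing `x`: coordinates `n⌊v_i∕n⌋ + ℓ⌊(v_i mod n)∕ℓ⌋ + t_i`. [folklore] -/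
def boxPt (x : Tor (fine n M)) (t : Fin (d + 1) → ℕ) : Tor (fine n M) :=
  fun i => ((n * ((x i).val / n) + ℓ * (((x i).val % n) / ℓ) + t i : ℕ) : ZMod (fine n M i))

variable {ℓ}

/-- the corner offset plus `t < ℓ` stays inside the unit block (`ℓ ∣ n`). [folklore] -/
theorem box_digits_lt (hℓn : ℓ ∣ n) {v t : ℕ} (ht : t < ℓ) : ℓ * ((v % n) / ℓ) + t < n := by
  obtain ⟨c, hc⟩ := hℓn
  have hℓ0 : 0 < ℓ := by omega
  have hn0 : 0 < n := Nat.pos_of_ne_zero (NeZero.ne n)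
  have hq : (v % n) / ℓ < c := by
    rw [Nat.div_lt_iff_lt_mul hℓ0]
    calc v % n < n := Nat.mod_lt v hn0
      _ = c * ℓ := by rw [hc, mul_comm]
  calc ℓ * ((v % n) / ℓ) + t < ℓ * ((v % n) / ℓ) + ℓ := by omega
    _ = ℓ * ((v % n) / ℓ + 1) := by ring
    _ ≤ ℓ * c := Nat.mul_le_mul_left ℓ hq
    _ = n := by rw [hc]

/-- the coordinate of a sub-box point as a natural number. [folklore] -/
theorem boxPt_val (hℓn : ℓ ∣ n) (x : Tor (fine n M)) {t : Fin (d + 1) → ℕ} (ht : ∀ i, t i < ℓ) (i : Fin (d + 1)) :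
    (boxPt M n ℓ x t i).val = n * ((x i).val / n) + ℓ * (((x i).val % n) / ℓ) + t i := by
  have hn0 : 0 < n := Nat.pos_of_ne_zero (NeZero.ne n)
  have hv : (x i).val < n * M i := ZMod.val_lt (x i)
  have hq : (x i).val / n < M i := by rw [Nat.div_lt_iff_lt_mul hn0]; rw [mul_comm]; exact hv
  have hlt : n * ((x i).val / n) + ℓ * (((x i).val % n) / ℓ) + t i < fine n M i := by
    have h1 := box_digits_lt n hℓn (v := (x i).val) (ht i)
    show _ < n * M i
    calc n * ((x i).val / n) + ℓ * (((x i).val % n) / ℓ) + t i < n * ((x i).val / n) + n := by omega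
      _ = n * ((x i).val / n + 1) := by ring
      _ ≤ n * M i := Nat.mul_le_mul_left n hq
  rw [boxPt, ZMod.val_cast_of_lt hlt]

/-- ★ a sub-box point lies in the SAME unit block (`ℓ ∣ n`, `t < ℓ`). [folklore] -/
theorem blockOf_boxPt (hℓn : ℓ ∣ n) (x : Tor (fine n M)) {t : Fin (d + 1) → ℕ} (ht : ∀ i, t i < ℓ) : blockOf n M (boxPt M n ℓ x t) = blockOf n M x := by
  have hn0 : 0 < n := Nat.pos_of_ne_zero (NeZero.ne n)
  funext i
  refine ZMod.val_injective _ ?_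
  rw [val_blockOf, val_blockOf, boxPt_val M n hℓn x ht i, add_assoc, Nat.mul_add_div hn0, Nat.div_eq_of_lt (box_digits_lt n hℓn (ht i)), add_zero]

/-- `x` is the point of its own sub-box with offset `r_i = (v_i mod n) mod ℓ`. [folklore] -/
theorem boxPt_rem (x : Tor (fine n M)) : boxPt M n ℓ x (fun i => ((x i).val % n) % ℓ) = x := by
  funext i
  rw [boxPt, add_assoc, Nat.div_add_mod, Nat.div_add_mod, ZMod.natCast_zmod_val]

omit [∀ μ, NeZero (M μ)] [NeZero n] in
/-- the sub-box point with offset `t` is the corner shifted by `Σ_i t_i e_i`. [folklore] -/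
theorem boxPt_eq_corner_add (x : Tor (fine n M)) (t : Fin (d + 1) → ℕ) :
    boxPt M n ℓ x t = boxPt M n ℓ x (fun _ => 0) + ∑ i : Fin (d + 1), t i • unitVec (fine n M) i := by
  funext i
  rw [Pi.add_apply, Finset.sum_apply, Finset.sum_eq_single i (fun j _ hj => by rw [Pi.smul_apply, unitVec, Pi.single_eq_of_ne hj.symm, smul_zero])
    (fun h => absurd (Finset.mem_univ i) h), Pi.smul_apply, unitVec, Pi.single_eq_same, boxPt, boxPt, nsmul_eq_mul, mul_one]
  push_cast
  ring

/-- distinct offsets `< ℓ` give distinct sub-box points. [folklore] -/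
theorem boxPt_injective (hℓn : ℓ ∣ n) (x : Tor (fine n M)) : Function.Injective (fun t : Fin (d + 1) → Fin ℓ => boxPt M n ℓ x (fun i => (t i : ℕ))) := by
  intro t t' h
  funext i
  have hv := congrArg (fun z : Tor (fine n M) => (z i).val) h
  simp only at hv
  rw [boxPt_val M n hℓn x (fun i => (t i).is_lt), boxPt_val M n hℓn x (fun i => (t' i).is_lt)] at hv
  exact Fin.ext (by omega)

omit [∀ μ, NeZero (M μ)] [NeZero n] in
/-- the product of directional shifts acts as the shift by the sum: `ρ(Π_i s_i^{t_i})g (z, κ) = g(z + Σ_i t_i e_i, κ)`. [folklore] -/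
theorem symbOp_prod_sT_pow_apply (t : Fin (d + 1) → ℕ) (g : Tor (fine n M) × Fin (d + 1) → ℝ) (z : Tor (fine n M) × Fin (d + 1)) :
    symbOp M n (∏ i : Fin (d + 1), sT M n i ^ t i) g z = g (z.1 + ∑ i : Fin (d + 1), t i • unitVec (fine n M) i, z.2) := by
  simp only [sT_pow]
  rw [AddMonoidAlgebra.prod_single, Finset.prod_const_one, symbOp_single_apply, one_mul]

variable (ℓ)

/-- **THE SUB-BOX AVERAGE**: `(subAvg g)(x, κ) = ℓ^{−(d+1)}·Σ_{t ∈ [0,ℓ)^{d+1}} g(boxPt x t, κ)`. [folklore] -/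
noncomputable def subAvg : (Tor (fine n M) × Fin (d + 1) → ℝ) →ₗ[ℝ] (Tor (fine n M) × Fin (d + 1) → ℝ) where
  toFun g := fun z => (((ℓ : ℝ) ^ (d + 1))⁻¹) * ∑ t : Fin (d + 1) → Fin ℓ, g (boxPt M n ℓ z.1 (fun i => (t i : ℕ)), z.2)
  map_add' g g' := by funext z; simp only [Pi.add_apply, sum_add_distrib, mul_add]
  map_smul' c g := by funext z; simp only [Pi.smul_apply, smul_eq_mul, RingHom.id_apply, ← mul_sum]; ring

omit [∀ μ, NeZero (M μ)] [NeZero n] in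
/-- pointwise form. [folklore] -/
theorem subAvg_apply (g : Tor (fine n M) × Fin (d + 1) → ℝ) (z : Tor (fine n M) × Fin (d + 1)) :
    subAvg M n ℓ g z = (((ℓ : ℝ) ^ (d + 1))⁻¹) * ∑ t : Fin (d + 1) → Fin ℓ, g (boxPt M n ℓ z.1 (fun i => (t i : ℕ)), z.2) := rfl

end Box

/-! ## §110 ★ The sub-box average is controlled by the L²-block norm: `√((n∕ℓ)^{d+1})` -/

section Avg

variable {L : ℕ} (M : Fin (d + 1) → ℕ) [∀ μ, NeZero (M μ)] (k n : ℕ) [NeZero n] {ℓ : ℕ}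

/-- ★ `sup_{(x,κ) ∈ B(y)} |(subAvg g)(x, κ)| ≤ √((n∕ℓ)^{d+1})·loc_{L², η^{d+1}}(y, g)` (`1 ≤ ℓ`, `ℓ ∣ n`): Cauchy–Schwarz over the `ℓ^{d+1}` sub-box points, which are distinct and lie in
`B(y)`. [folklore] -/
theorem loc_subAvg_le (hℓ : 1 ≤ ℓ) (hℓn : ℓ ∣ n) (y : Tor M) (g : Tor (fine n M) × Fin (d + 1) → ℝ) :
    (BlockNorm.ofBlocks (unitTorusGeo L k M) (fun i : Tor (fine n M) × Fin (d + 1) => blockOf n M i.1)).loc y (subAvg M n ℓ g)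
      ≤ Real.sqrt (((n / ℓ : ℕ) : ℝ) ^ (d + 1))
        * (BlockNorm.l2Blocks (unitTorusGeo L k M) (fun i : Tor (fine n M) × Fin (d + 1) => blockOf n M i.1) (etaPow n (d + 1)) (etaPow_nonneg _ _)).loc y g := by
  classical
  set b2 := BlockNorm.l2Blocks (unitTorusGeo L k M) (fun i : Tor (fine n M) × Fin (d + 1) => blockOf n M i.1) (etaPow n (d + 1)) (etaPow_nonneg _ _) with hb2
  have hn0 : (0 : ℝ) < n := by exact_mod_cast Nat.pos_of_ne_zero (NeZero.ne n)
  have hℓ0 : (0 : ℝ) < ℓ := by exact_mod_cast hℓ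
  have hℓD : (0 : ℝ) < (ℓ : ℝ) ^ (d + 1) := pow_pos hℓ0 _
  have hcard : (Fintype.card (Fin (d + 1) → Fin ℓ) : ℝ) = (ℓ : ℝ) ^ (d + 1) := by
    rw [Fintype.card_fun, Fintype.card_fin, Fintype.card_fin]; push_cast; ring
  have hq : ((n / ℓ : ℕ) : ℝ) = (n : ℝ) / ℓ := Nat.cast_div hℓn hℓ0.ne'
  refine loc_ofBlocks_le (g := unitTorusGeo L k M) (fun i : Tor (fine n M) × Fin (d + 1) => blockOf n M i.1) _
    (mul_nonneg (Real.sqrt_nonneg _) (b2.loc_nonneg y g)) fun z hz => ?_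
  obtain ⟨x, κ⟩ := z
  simp only at hz
  rw [subAvg_apply]
  -- Cauchy–Schwarz over the sub-box
  set S : ℝ := ∑ t : Fin (d + 1) → Fin ℓ, g (boxPt M n ℓ x (fun i => (t i : ℕ)), κ) ^ 2 with hS
  have hS0 : 0 ≤ S := sum_nonneg fun _ _ => sq_nonneg _
  have hCS : |∑ t : Fin (d + 1) → Fin ℓ, g (boxPt M n ℓ x (fun i => (t i : ℕ)), κ)| ≤ Real.sqrt ((ℓ : ℝ) ^ (d + 1)) * Real.sqrt S := by
    rw [← Real.sqrt_mul hℓD.le, ← Real.sqrt_sq_eq_abs]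
    refine Real.sqrt_le_sqrt ?_
    have h := Finset.sum_mul_sq_le_sq_mul_sq univ (fun _ : Fin (d + 1) → Fin ℓ => (1 : ℝ)) (fun t => g (boxPt M n ℓ x (fun i => (t i : ℕ)), κ))
    simp only [one_mul, one_pow, sum_const, card_univ, nsmul_eq_mul, mul_one] at h
    rw [hcard] at h
    exact h
  -- the sub-box points are distinct bonds of `B(y)`
  have hsub : S ≤ ∑ z ∈ univ.filter (fun z : Tor (fine n M) × Fin (d + 1) => blockOf n M z.1 = y), g z ^ 2 := by
    have hinj : Set.InjOn (fun t : Fin (d + 1) → Fin ℓ => (boxPt M n ℓ x (fun i => (t i : ℕ)), κ)) (univ : Finset (Fin (d + 1) → Fin ℓ)) := by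
      intro t _ t' _ h
      exact boxPt_injective M n hℓn x (Prod.mk.inj h).1
    rw [hS, ← Finset.sum_image (f := fun z : Tor (fine n M) × Fin (d + 1) => g z ^ 2) hinj]
    refine Finset.sum_le_sum_of_subset_of_nonneg (fun z hz' => ?_) (fun _ _ _ => sq_nonneg _)
    rw [Finset.mem_image] at hz'
    obtain ⟨t, _, rfl⟩ := hz'
    rw [mem_filter]
    exact ⟨mem_univ _, by rw [blockOf_boxPt M n hℓn x (fun i => (t i).is_lt)]; exact hz⟩
  have hloc : Real.sqrt S ≤ Real.sqrt ((n : ℝ) ^ (d + 1)) * b2.loc y g := by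
    rw [hb2, loc_l2Blocks_eq, ← Real.sqrt_mul (pow_nonneg hn0.le _)]
    refine Real.sqrt_le_sqrt (hsub.trans (le_of_eq ?_))
    unfold etaPow
    rw [← mul_assoc, inv_pow, mul_inv_cancel₀ (pow_ne_zero _ hn0.ne'), one_mul]
  calc |(((ℓ : ℝ) ^ (d + 1))⁻¹) * ∑ t : Fin (d + 1) → Fin ℓ, g (boxPt M n ℓ x (fun i => (t i : ℕ)), κ)|
      = ((ℓ : ℝ) ^ (d + 1))⁻¹ * |∑ t : Fin (d + 1) → Fin ℓ, g (boxPt M n ℓ x (fun i => (t i : ℕ)), κ)| := by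
        rw [abs_mul, abs_of_pos (inv_pos.mpr hℓD)]
    _ ≤ ((ℓ : ℝ) ^ (d + 1))⁻¹ * (Real.sqrt ((ℓ : ℝ) ^ (d + 1)) * (Real.sqrt ((n : ℝ) ^ (d + 1)) * b2.loc y g)) :=
        mul_le_mul_of_nonneg_left (hCS.trans (mul_le_mul_of_nonneg_left hloc (Real.sqrt_nonneg _))) (inv_nonneg.mpr hℓD.le)
    _ = Real.sqrt (((n / ℓ : ℕ) : ℝ) ^ (d + 1)) * b2.loc y g := by
        rw [hq, div_pow, Real.sqrt_div' _ hℓD.le]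
        have hs : Real.sqrt ((ℓ : ℝ) ^ (d + 1)) ≠ 0 := (Real.sqrt_pos.mpr hℓD).ne'
        have hs2 : Real.sqrt ((ℓ : ℝ) ^ (d + 1)) * Real.sqrt ((ℓ : ℝ) ^ (d + 1)) = (ℓ : ℝ) ^ (d + 1) := Real.mul_self_sqrt hℓD.le
        rw [div_mul_eq_mul_div, eq_div_iff hs]
        calc ((ℓ : ℝ) ^ (d + 1))⁻¹ * (Real.sqrt ((ℓ : ℝ) ^ (d + 1)) * (Real.sqrt ((n : ℝ) ^ (d + 1)) * b2.loc y g)) * Real.sqrt ((ℓ : ℝ) ^ (d + 1))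
            = ((ℓ : ℝ) ^ (d + 1))⁻¹ * (Real.sqrt ((ℓ : ℝ) ^ (d + 1)) * Real.sqrt ((ℓ : ℝ) ^ (d + 1))) * (Real.sqrt ((n : ℝ) ^ (d + 1)) * b2.loc y g) := by ring
          _ = Real.sqrt ((n : ℝ) ^ (d + 1)) * b2.loc y g := by rw [hs2, inv_mul_cancel₀ hℓD.ne', one_mul]

/-- ★ **L²-BLOCK MAJORANT ⇒ SUP-BLOCK MAJORANT OF THE AVERAGED OPERATOR**: `HasMaj b₁ (l2Blocks η^D) T K ⇒ HasMaj b₁ (ofBlocks) (subAvg ℓ ∘ T) (√((n∕ℓ)^D)·K)`. [folklore] -/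
theorem HasMaj.subAvg_of_l2Blocks {F₁ : Type} [AddCommGroup F₁] [Module ℝ F₁] {b₁ : BlockNorm (unitTorusGeo L k M) F₁} (hℓ : 1 ≤ ℓ) (hℓn : ℓ ∣ n)
    {T : F₁ →ₗ[ℝ] (Tor (fine n M) × Fin (d + 1) → ℝ)} {K : Tor M → Tor M → ℝ}
    (h : HasMaj b₁ (BlockNorm.l2Blocks (unitTorusGeo L k M) (fun i : Tor (fine n M) × Fin (d + 1) => blockOf n M i.1) (etaPow n (d + 1)) (etaPow_nonneg _ _)) T K) :
    HasMaj b₁ (BlockNorm.ofBlocks (unitTorusGeo L k M) (fun i : Tor (fine n M) × Fin (d + 1) => blockOf n M i.1)) (subAvg M n ℓ ∘ₗ T)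
      (fun y y' => Real.sqrt (((n / ℓ : ℕ) : ℝ) ^ (d + 1)) * K y y') := by
  intro y' μ hμ y
  rw [LinearMap.comp_apply, mul_assoc]
  exact (loc_subAvg_le M k n hℓ hℓn y (T μ)).trans (mul_le_mul_of_nonneg_left (h y' μ hμ y) (Real.sqrt_nonneg _))

end Avg

/-! ## §111 The oscillation part `g − subAvg g` -/

section Osc

variable {L : ℕ} (M : Fin (d + 1) → ℕ) [∀ μ, NeZero (M μ)] (k n : ℕ) [NeZero n] {F₁ : Type} [AddCommGroup F₁] [Module ℝ F₁]

/-- **A PRODUCT OF DIRECTIONAL MULTI-STEP DIFFERENCES**: if every `(ρ(s_i^{t_i}) − 1)∘T` (`i ∈ s`) has the sup majorant `B·e^{−ρd}` and `t_i ≤ n`, then `(ρ(Π_{i∈s} s_i^{t_i}) − 1)∘T` has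
`|s|·e^{|s|ρ}·B·e^{−ρd}` (telescoping `ab − 1 = a(b − 1) + (a − 1)` and the shift transfer of part 40). [folklore] -/
theorem hasMaj_prod_sT_pow_sub_one {b₁ : BlockNorm (unitTorusGeo L k M) F₁} {T : F₁ →ₗ[ℝ] (Tor (fine n M) × Fin (d + 1) → ℝ)} {B ρ : ℝ} (hB : 0 ≤ B) (hρ : 0 ≤ ρ)
    {t : Fin (d + 1) → ℕ} (htn : ∀ i, t i ≤ n)
    (hosc : ∀ i : Fin (d + 1), HasMaj b₁ (BlockNorm.ofBlocks (unitTorusGeo L k M) (fun z : Tor (fine n M) × Fin (d + 1) => blockOf n M z.1))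
      (symbOp M n (sT M n i ^ t i - 1) ∘ₗ T) (fun y y' => B * Real.exp (-(ρ * tdistT M y y'))))
    (s : Finset (Fin (d + 1))) :
    HasMaj b₁ (BlockNorm.ofBlocks (unitTorusGeo L k M) (fun z : Tor (fine n M) × Fin (d + 1) => blockOf n M z.1))
      (symbOp M n (∏ i ∈ s, sT M n i ^ t i - 1) ∘ₗ T) (fun y y' => (s.card : ℝ) * Real.exp ρ ^ s.card * B * Real.exp (-(ρ * tdistT M y y'))) := by
  classical
  induction s using Finset.induction_on with
  | empty =>
      rw [prod_empty, sub_self, map_zero, LinearMap.zero_comp]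
      exact (B11SectG.hasMaj_zero _ _).mono fun y y' => by rw [card_empty]; simp
  | insert j s hj ih =>
      have he1 : 1 ≤ Real.exp ρ := Real.one_le_exp hρ
      have hsB : 0 ≤ (s.card : ℝ) * Real.exp ρ ^ s.card * B := by positivity
      -- `ab − 1 = a(b − 1) + (a − 1)`
      have hop : symbOp M n (∏ i ∈ insert j s, sT M n i ^ t i - 1) ∘ₗ T
          = symbOp M n (sT M n j ^ t j) ∘ₗ (symbOp M n (∏ i ∈ s, sT M n i ^ t i - 1) ∘ₗ T) + symbOp M n (sT M n j ^ t j - 1) ∘ₗ T := by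
        rw [prod_insert hj, show sT M n j ^ t j * ∏ i ∈ s, sT M n i ^ t i - 1 = sT M n j ^ t j * (∏ i ∈ s, sT M n i ^ t i - 1) + (sT M n j ^ t j - 1) by ring,
          map_add, map_mul, LinearMap.add_comp, Module.End.mul_eq_comp, LinearMap.comp_assoc]
      rw [hop]
      have h1 := hasMaj_sT_pow_comp M k n hsB hρ j (htn j) ih
      refine (h1.add (hosc j)).mono fun y y' => ?_
      rw [card_insert_of_notMem hj]
      push_cast
      have hE := Real.exp_nonneg (-(ρ * tdistT M y y'))
      have hpow : Real.exp ρ ^ s.card ≤ Real.exp ρ ^ (s.card + 1) := pow_le_pow_right₀ he1 (Nat.le_succ _)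
      have hpow1 : 1 ≤ Real.exp ρ ^ (s.card + 1) := one_le_pow₀ he1
      have hc0 : (0 : ℝ) ≤ s.card := Nat.cast_nonneg _
      calc (s.card : ℝ) * Real.exp ρ ^ s.card * B * Real.exp ρ * Real.exp (-(ρ * tdistT M y y')) + B * Real.exp (-(ρ * tdistT M y y'))
          = ((s.card : ℝ) * (Real.exp ρ ^ (s.card + 1)) * B + 1 * B) * Real.exp (-(ρ * tdistT M y y')) := by ring
        _ ≤ ((s.card : ℝ) * (Real.exp ρ ^ (s.card + 1)) * B + Real.exp ρ ^ (s.card + 1) * B) * Real.exp (-(ρ * tdistT M y y')) := by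
            gcongr
        _ = ((s.card : ℝ) + 1) * Real.exp ρ ^ (s.card + 1) * B * Real.exp (-(ρ * tdistT M y y')) := by ring

/-- ★ **THE OSCILLATION PART**: if every product difference `(ρ(Π_i s_i^{t_i}) − 1)∘T` with `t < ℓ` has the sup majorant `K` (`K ≥ 0`), then `T − subAvg ℓ∘T` has `2K` (`ℓ ∣ n`): at `x`, both `(Tμ)(x)`
and every `(Tμ)(boxPt x t)` differ from the value at the sub-box corner by such a difference EVALUATED IN `B(y)`. [folklore] -/
theorem hasMaj_sub_subAvg {b₁ : BlockNorm (unitTorusGeo L k M) F₁} {T : F₁ →ₗ[ℝ] (Tor (fine n M) × Fin (d + 1) → ℝ)} {ℓ : ℕ} (hℓ : 1 ≤ ℓ) (hℓn : ℓ ∣ n)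
    {K : Tor M → Tor M → ℝ} (hK : ∀ y y', 0 ≤ K y y')
    (hprod : ∀ t : Fin (d + 1) → ℕ, (∀ i, t i < ℓ) → HasMaj b₁ (BlockNorm.ofBlocks (unitTorusGeo L k M) (fun z : Tor (fine n M) × Fin (d + 1) => blockOf n M z.1))
      (symbOp M n (∏ i : Fin (d + 1), sT M n i ^ t i - 1) ∘ₗ T) K) :
    HasMaj b₁ (BlockNorm.ofBlocks (unitTorusGeo L k M) (fun z : Tor (fine n M) × Fin (d + 1) => blockOf n M z.1)) (T - subAvg M n ℓ ∘ₗ T)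
      (fun y y' => 2 * K y y') := by
  classical
  have hℓ0 : (0 : ℝ) < ℓ := by exact_mod_cast hℓ
  have hℓD : (0 : ℝ) < (ℓ : ℝ) ^ (d + 1) := pow_pos hℓ0 _
  have hcard : (Fintype.card (Fin (d + 1) → Fin ℓ) : ℝ) = (ℓ : ℝ) ^ (d + 1) := by
    rw [Fintype.card_fun, Fintype.card_fin, Fintype.card_fin]; push_cast; ring
  intro y' μ hμ y
  refine loc_ofBlocks_le (g := unitTorusGeo L k M) (fun z : Tor (fine n M) × Fin (d + 1) => blockOf n M z.1) _
    (mul_nonneg (mul_nonneg zero_le_two (hK y y')) (b₁.loc_nonneg y' μ)) fun z hz => ?_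
  obtain ⟨x, κ⟩ := z
  simp only at hz
  set g := T μ with hg
  set c : Tor (fine n M) := boxPt M n ℓ x (fun _ => 0) with hc
  have hcblk : blockOf n M c = y := by rw [hc, blockOf_boxPt M n hℓn x (fun _ => hℓ)]; exact hz
  -- every sub-box value minus the corner value is a product difference at the corner
  have hval : ∀ t : Fin (d + 1) → ℕ, (∀ i, t i < ℓ) → |g (boxPt M n ℓ x t, κ) - g (c, κ)| ≤ K y y' * b₁.loc y' μ := by
    intro t ht
    have e : g (boxPt M n ℓ x t, κ) - g (c, κ) = (symbOp M n (∏ i : Fin (d + 1), sT M n i ^ t i - 1) ∘ₗ T) μ (c, κ) := by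
      rw [LinearMap.comp_apply, map_sub, map_one, LinearMap.sub_apply, Module.End.one_apply, Pi.sub_apply, symbOp_prod_sT_pow_apply, ← hg,
        boxPt_eq_corner_add M n x t]
    rw [e]
    exact (abs_le_loc_ofBlocks (g := unitTorusGeo L k M) (fun z : Tor (fine n M) × Fin (d + 1) => blockOf n M z.1) _ hcblk).trans ((hprod t ht) y' μ hμ y)
  -- `x` itself
  have hx : |g (x, κ) - g (c, κ)| ≤ K y y' * b₁.loc y' μ := by
    have h := hval (fun i => ((x i).val % n) % ℓ) (fun i => Nat.mod_lt _ (by omega))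
    rwa [boxPt_rem] at h
  -- the average
  rw [LinearMap.sub_apply, LinearMap.comp_apply, Pi.sub_apply, subAvg_apply, ← hg]
  have havg : |g (c, κ) - (((ℓ : ℝ) ^ (d + 1))⁻¹) * ∑ t : Fin (d + 1) → Fin ℓ, g (boxPt M n ℓ x (fun i => (t i : ℕ)), κ)| ≤ K y y' * b₁.loc y' μ := by
    have e : g (c, κ) - (((ℓ : ℝ) ^ (d + 1))⁻¹) * ∑ t : Fin (d + 1) → Fin ℓ, g (boxPt M n ℓ x (fun i => (t i : ℕ)), κ)
        = (((ℓ : ℝ) ^ (d + 1))⁻¹) * ∑ t : Fin (d + 1) → Fin ℓ, (g (c, κ) - g (boxPt M n ℓ x (fun i => (t i : ℕ)), κ)) := by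
      rw [Finset.sum_sub_distrib, sum_const, card_univ, nsmul_eq_mul, hcard, mul_sub, ← mul_assoc, inv_mul_cancel₀ hℓD.ne', one_mul]
    rw [e, abs_mul, abs_of_pos (inv_pos.mpr hℓD)]
    calc ((ℓ : ℝ) ^ (d + 1))⁻¹ * |∑ t : Fin (d + 1) → Fin ℓ, (g (c, κ) - g (boxPt M n ℓ x (fun i => (t i : ℕ)), κ))|
        ≤ ((ℓ : ℝ) ^ (d + 1))⁻¹ * ∑ t : Fin (d + 1) → Fin ℓ, |g (c, κ) - g (boxPt M n ℓ x (fun i => (t i : ℕ)), κ)| :=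
          mul_le_mul_of_nonneg_left (abs_sum_le_sum_abs _ _) (inv_nonneg.mpr hℓD.le)
      _ ≤ ((ℓ : ℝ) ^ (d + 1))⁻¹ * ∑ _t : Fin (d + 1) → Fin ℓ, K y y' * b₁.loc y' μ := by
          refine mul_le_mul_of_nonneg_left (sum_le_sum fun t _ => ?_) (inv_nonneg.mpr hℓD.le)
          rw [abs_sub_comm]
          exact hval (fun i => (t i : ℕ)) (fun i => (t i).is_lt)
      _ = K y y' * b₁.loc y' μ := by rw [sum_const, card_univ, nsmul_eq_mul, hcard, ← mul_assoc, inv_mul_cancel₀ hℓD.ne', one_mul]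
  calc |g (x, κ) - (((ℓ : ℝ) ^ (d + 1))⁻¹) * ∑ t : Fin (d + 1) → Fin ℓ, g (boxPt M n ℓ x (fun i => (t i : ℕ)), κ)|
      = |(g (x, κ) - g (c, κ)) + (g (c, κ) - (((ℓ : ℝ) ^ (d + 1))⁻¹) * ∑ t : Fin (d + 1) → Fin ℓ, g (boxPt M n ℓ x (fun i => (t i : ℕ)), κ))| := by ring_nf
    _ ≤ |g (x, κ) - g (c, κ)| + |g (c, κ) - (((ℓ : ℝ) ^ (d + 1))⁻¹) * ∑ t : Fin (d + 1) → Fin ℓ, g (boxPt M n ℓ x (fun i => (t i : ℕ)), κ)| := abs_add_le _ _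
    _ ≤ K y y' * b₁.loc y' μ + K y y' * b₁.loc y' μ := add_le_add hx havg
    _ = 2 * K y y' * b₁.loc y' μ := by ring

/-! ## §112 ★★ Sup-block majorant from the L²-block majorant and the multi-step oscillations -/

/-- ★★ **INTERPOLATION**: `HasMaj b₁ (l2Blocks η^D) T (B₂e^{−ρd})` and, for all directions `i` and step counts `t < ℓ`, `HasMaj b₁ (ofBlocks) ((ρ(s_i^t) − 1)∘T) (B_osc e^{−ρd})` give
`HasMaj b₁ (ofBlocks) T ((√((n∕ℓ)^{d+1})·B₂ + 2(d+1)e^{(d+1)ρ}B_osc)·e^{−ρd})` (`1 ≤ ℓ ≤ n`, `ℓ ∣ n`). [folklore] -/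
theorem hasMaj_sup_of_l2Blocks_osc {b₁ : BlockNorm (unitTorusGeo L k M) F₁} {T : F₁ →ₗ[ℝ] (Tor (fine n M) × Fin (d + 1) → ℝ)} {ℓ : ℕ} (hℓ : 1 ≤ ℓ) (hℓn : ℓ ∣ n)
    {B₂ Bosc ρ : ℝ} (hBosc : 0 ≤ Bosc) (hρ : 0 ≤ ρ)
    (h2 : HasMaj b₁ (BlockNorm.l2Blocks (unitTorusGeo L k M) (fun z : Tor (fine n M) × Fin (d + 1) => blockOf n M z.1) (etaPow n (d + 1)) (etaPow_nonneg _ _)) T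
      (fun y y' => B₂ * Real.exp (-(ρ * tdistT M y y'))))
    (hosc : ∀ (i : Fin (d + 1)) (t : ℕ), t < ℓ → HasMaj b₁ (BlockNorm.ofBlocks (unitTorusGeo L k M) (fun z : Tor (fine n M) × Fin (d + 1) => blockOf n M z.1))
      (symbOp M n (sT M n i ^ t - 1) ∘ₗ T) (fun y y' => Bosc * Real.exp (-(ρ * tdistT M y y')))) :
    HasMaj b₁ (BlockNorm.ofBlocks (unitTorusGeo L k M) (fun z : Tor (fine n M) × Fin (d + 1) => blockOf n M z.1)) T
      (fun y y' => (Real.sqrt (((n / ℓ : ℕ) : ℝ) ^ (d + 1)) * B₂ + 2 * ((d : ℝ) + 1) * Real.exp ρ ^ (d + 1) * Bosc) * Real.exp (-(ρ * tdistT M y y'))) := by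
  classical
  have hℓn' : ℓ ≤ n := Nat.le_of_dvd (Nat.pos_of_ne_zero (NeZero.ne n)) hℓn
  have hA := HasMaj.subAvg_of_l2Blocks M k n hℓ hℓn h2
  have hprod : ∀ t : Fin (d + 1) → ℕ, (∀ i, t i < ℓ) → HasMaj b₁ (BlockNorm.ofBlocks (unitTorusGeo L k M) (fun z : Tor (fine n M) × Fin (d + 1) => blockOf n M z.1))
      (symbOp M n (∏ i : Fin (d + 1), sT M n i ^ t i - 1) ∘ₗ T) (fun y y' => ((d : ℝ) + 1) * Real.exp ρ ^ (d + 1) * Bosc * Real.exp (-(ρ * tdistT M y y'))) := by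
    intro t ht
    have h := hasMaj_prod_sT_pow_sub_one M k n hBosc hρ (t := t) (fun i => ((ht i).le).trans hℓn') (fun i => hosc i (t i) (ht i)) univ
    refine h.mono fun y y' => le_of_eq ?_
    rw [card_univ, Fintype.card_fin]; push_cast; ring
  have hO := hasMaj_sub_subAvg M k n hℓ hℓn (fun y y' => by positivity) hprod
  refine ((hA.add hO).congr fun μ => ?_).mono fun y y' => le_of_eq (by ring)
  rw [LinearMap.add_apply, LinearMap.sub_apply]; abel

end Osc

end Summit.QuantumFields.YangMills.BalabanUVNodes.N15.TwoGrid
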